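import Literature.NumberTheory.Weil1964.AdelicMetaplecticRationalLiftSum
import HarnessLib

/-!
# Origin scalars of Weil operators survive block-diagonal rational conjugation on the doubled space
# `𝒮(𝔸^{n ⊕ n}) = 𝒮(𝔸ⁿ) ⊠̂ 𝒮(𝔸ⁿ)` ([Weil1964] Chap. III n° 38, n° 41 Thm 6)

Topic `NumberTheory/Weil1964`; namespace `Literature.NumberTheory.Weil1964`.  KERNEL MATHEMATICS ONLY (theorems; no definition, no
named fact, no proof hole).  Continuation of ★ `AdelicMetaplecticRationalLiftSum` (`ω(r_F^□(x₁ ⊕ x₂))(Φ₁ ⊠ Ψ₂) = ω(r_F x₁)Φ₁ ⊠ ω₋(r_F x₂)Ψ₂`).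

The «origin value» of `Φ ∈ 𝒮(𝔸_F^ι)` is `Φ(0)`; an operator has «origin scalar `c`» if `(ω q Φ)(0) = c · Φ(0)` for all `Φ`.  For the
doubled carrier `𝕋 = doubledGramFin F T` on `Fin (n + n)` (`T` on `Fin n`, `hT : IsUnit T.det`) and pure tensors
`Φ₁ ⊠ Ψ₂ := sumTensor F finSumFinEquiv.symm Φ₁ Ψ₂` (second factor in the `−T` model):

* (β0) `coe_sumTensor_apply_zero` — `(Φ₁ ⊠ Ψ₂)(0) = Φ₁(0) · Ψ₂(0)`;
* (β1) `omega_conj_ratThetaLiftCont_sumTensor` — BLOCK-DIAGONAL CONJUGATION: if `x ∈ Sp_{2(n+n)}(F)` is the rational block-diagonal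
  `x₁ ⊕ x₂` (the hypothesis shape of ★ `omega_ratThetaLiftCont_sumTensor_of_ratSp_eq`) and `M ∈ Mp((W ⊕ W⁻)_𝔸)ᶜᵒⁿᵗ` acts on pure tensors
  as `S ⊠ 1` (`ω□ M (Φ₁ ⊠ Ψ₂) = ω S Φ₁ ⊠ Ψ₂`), then `r_F^□(x) · M · r_F^□(x)⁻¹` acts on pure tensors as `(r_F x₁ · S · (r_F x₁)⁻¹) ⊠ 1`
  — the `ω₋(r_F x₂)^{±1}` factors cancel on `Ψ₂`;
* (β2) `originScalar_of_sumTensor` — DESCENT OF THE ORIGIN SCALAR FROM `A ⊠ 1`: if `ω□ N (Φ₁ ⊠ Ψ₂) = ω A Φ₁ ⊠ Ψ₂` for all pure tensors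
  and `N` has origin scalar `c` on pure tensors, then `A` has origin scalar `c` — tested on ONE `Ψ₂` with `Ψ₂(0) ≠ 0`; and the converse
  `originScalar_sumTensor_of_factor`.

Consumer: the model identification #42N of the rank-two doubling method ([Liu2021, App. B]; tree socket U6), step (N-c′): the origin scalar
`χ(det_Δ^𝔻 g)|det|^{1/2}` is carried from the big model to model (ii) through `𝐫₀(u)`-conjugation (★ Summits-side (α)) and a block-diagonal
mover `γ′ = δ ⊕ δ` ((β1) + (β2) here).

## References
* [Weil1964] A. Weil, Sur certains groupes d'opérateurs unitaires, Acta Math. 111 (1964), Chap. III n° 38 pp. 189–190, n° 41 Thm 6 p. 193.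
* [Kudla1994] S. S. Kudla, Israel J. Math. 87 (1994), §1.  [MoeglinVignerasWaldspurger1987] LNM 1291, Chap. 2 II.1 Rem. (6).
-/

set_option autoImplicit false

noncomputable section

open NumberField

namespace Literature.NumberTheory.Weil1964

open Literature.RepresentationTheory.HeisenbergGroup Literature.NumberTheory.Automorphic
open Literature.NumberTheory.Automorphic.UnitaryGroup (spReindex spSum)

/-! ## (β0) Origin values of pure tensors -/

section OriginValue

variable (F : Type) [Field F] [NumberField F] {κ κ₁ κ₂ : Type} [Fintype κ] [Fintype κ₁] [Fintype κ₂] (e : κ ≃ κ₁ ⊕ κ₂)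

/-- **`(Φ₁ ⊠ Φ₂)(0) = Φ₁(0) · Φ₂(0)`** (any coordinate splitting `e`). [cite: Weil1964, Chap. III n° 38 pp. 189–190] -/
theorem coe_sumTensor_apply_zero' (Φ₁ : piSchwartzBruhat F κ₁) (Φ₂ : piSchwartzBruhat F κ₂) :
    (sumTensor F e Φ₁ Φ₂ : (κ → AdeleRing (𝓞 F) F) → ℂ) 0 =
      (Φ₁ : (κ₁ → AdeleRing (𝓞 F) F) → ℂ) 0 * (Φ₂ : (κ₂ → AdeleRing (𝓞 F) F) → ℂ) 0 := by
  rw [coe_sumTensor_apply]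
  rfl

end OriginValue

section RationalSum

variable (F : Type) [Field F] [NumberField F] {n : ℕ}
variable (T : Matrix (Fin n) (Fin n) (AdeleRing (𝓞 F) F)) (hT : IsUnit T.det) (hT' : IsUnit (-T).det)

/-- **`(Φ₁ ⊠ Ψ₂)(0) = Φ₁(0) · Ψ₂(0)`** for the doubled space `Fin (n + n)` (currency of ★ `omega_ratThetaLiftCont_sumTensor_of_ratSp_eq`).
[cite: Weil1964, Chap. III n° 38 pp. 189–190] -/
theorem coe_sumTensor_apply_zero (Φ₁ Ψ₂ : piSchwartzBruhat F (Fin n)) :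
    (sumTensor F finSumFinEquiv.symm Φ₁ Ψ₂ : (Fin (n + n) → AdeleRing (𝓞 F) F) → ℂ) 0 =
      (Φ₁ : (Fin n → AdeleRing (𝓞 F) F) → ℂ) 0 * (Ψ₂ : (Fin n → AdeleRing (𝓞 F) F) → ℂ) 0 :=
  coe_sumTensor_apply_zero' F finSumFinEquiv.symm Φ₁ Ψ₂

/-! ## (β1) Block-diagonal rational conjugation of an operator of the form `S ⊠ 1` -/

/-- `ω(a b c) v = ω(a)(ω(b)(ω(c) v))` (abstract elements; kept off the big goals). [cite: Weil1964, Chap. III n° 38 pp. 189–190] -/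
private theorem omega_mul_mul_apply {ι : Type} [Fintype ι] [DecidableEq ι] (S₀ : Matrix ι ι (AdeleRing (𝓞 F) F)) (a b c : adelicMpCont F ι S₀)
    (v : piSchwartzBruhat F ι) :
    adelicMpCont.omega F ι S₀ (a * b * c) v =
      adelicMpCont.omega F ι S₀ a (adelicMpCont.omega F ι S₀ b (adelicMpCont.omega F ι S₀ c v)) :=
  (congrArg (fun t : Module.End ℂ (piSchwartzBruhat F ι) => t v)
    (((adelicMpCont.omega F ι S₀).map_mul (a * b) c).trans
      (congrArg (fun t : Module.End ℂ (piSchwartzBruhat F ι) => t * adelicMpCont.omega F ι S₀ c)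
        ((adelicMpCont.omega F ι S₀).map_mul a b)))).trans
    ((Module.End.mul_apply _ _ v).trans (Module.End.mul_apply _ _ _))

/-- `ω(a)(ω(a⁻¹) v) = v` (abstract elements). [cite: Weil1964, Chap. III n° 38 pp. 189–190] -/
private theorem omega_apply_omega_inv_apply {ι : Type} [Fintype ι] [DecidableEq ι] (S₀ : Matrix ι ι (AdeleRing (𝓞 F) F))
    (a : adelicMpCont F ι S₀) (v : piSchwartzBruhat F ι) :
    adelicMpCont.omega F ι S₀ a (adelicMpCont.omega F ι S₀ a⁻¹ v) = v :=
  (Module.End.mul_apply _ _ v).symm.trans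
    ((congrArg (fun t : Module.End ℂ (piSchwartzBruhat F ι) => t v)
      ((((adelicMpCont.omega F ι S₀).map_mul a a⁻¹).symm.trans
        (congrArg (adelicMpCont.omega F ι S₀) (mul_inv_cancel a))).trans (adelicMpCont.omega F ι S₀).map_one)).trans
      (Module.End.one_apply v))


include hT in
/-- the inverse of a rational block-diagonal point is the block-diagonal of the inverses (hypothesis shape of
★ `omega_ratThetaLiftCont_sumTensor_of_ratSp_eq`, transported to `x⁻¹`). [cite: Weil1964, Chap. III n° 38 pp. 189–190] -/
theorem ratSp_inv_eq_spSum (x : Matrix.symplecticGroup (Fin (n + n)) F) (x₁ x₂ : Matrix.symplecticGroup (Fin n) F)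
    (hx : ratSp F (doubledGramFin F T) (isUnit_det_doubledGramFin F T hT) x =
      spReindex finSumFinEquiv (Matrix.fromBlocks T 0 0 (-T)) (spSum T (-T) (ratSp F T hT x₁, ratSp F (-T) hT' x₂))) :
    ratSp F (doubledGramFin F T) (isUnit_det_doubledGramFin F T hT) x⁻¹ =
      spReindex finSumFinEquiv (Matrix.fromBlocks T 0 0 (-T)) (spSum T (-T) (ratSp F T hT x₁⁻¹, ratSp F (-T) hT' x₂⁻¹)) :=
  (map_inv (ratSp F (doubledGramFin F T) (isUnit_det_doubledGramFin F T hT)) x).trans <|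
    (congrArg (·⁻¹) hx).trans <|
      (map_inv (spReindex finSumFinEquiv (Matrix.fromBlocks T 0 0 (-T))) _).symm.trans <|
        congrArg (spReindex finSumFinEquiv (Matrix.fromBlocks T 0 0 (-T))) <|
          (map_inv (spSum T (-T)) _).symm.trans <| congrArg (spSum T (-T)) <|
            (Prod.inv_mk _ _).trans (Prod.ext (map_inv (ratSp F T hT) x₁).symm (map_inv (ratSp F (-T) hT') x₂).symm)

include hT in
/-- **BLOCK-DIAGONAL CONJUGATION of `S ⊠ 1`**: over a rational block-diagonal point `x = x₁ ⊕ x₂` of `Sp((W ⊕ W⁻)_𝔸)`, an element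
`M ∈ Mp((W ⊕ W⁻)_𝔸)ᶜᵒⁿᵗ` acting on pure tensors as `ω S ⊠ 1` conjugates under Weil's lift `r_F^□(x)` to an element acting on pure tensors as
`ω(r_F x₁ · S · (r_F x₁)⁻¹) ⊠ 1` — the `ω₋(r_F x₂)^{±1}` factors cancel on the second slot (★ `omega_ratThetaLiftCont_sumTensor_of_ratSp_eq`
at `x` and at `x⁻¹`). [cite: Weil1964, Chap. III n° 38 pp. 189–190 and n° 41 Thm 6 p. 193] -/
theorem omega_conj_ratThetaLiftCont_sumTensor (x : Matrix.symplecticGroup (Fin (n + n)) F)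
    (x₁ x₂ : Matrix.symplecticGroup (Fin n) F)
    (hx : ratSp F (doubledGramFin F T) (isUnit_det_doubledGramFin F T hT) x =
      spReindex finSumFinEquiv (Matrix.fromBlocks T 0 0 (-T)) (spSum T (-T) (ratSp F T hT x₁, ratSp F (-T) hT' x₂)))
    (M : adelicMpCont F (Fin (n + n)) (doubledGramFin F T)) (S : adelicMpCont F (Fin n) T)
    (hM : ∀ Φ₁ Ψ₂ : piSchwartzBruhat F (Fin n),
      adelicMpCont.omega F (Fin (n + n)) (doubledGramFin F T) M (sumTensor F finSumFinEquiv.symm Φ₁ Ψ₂) =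
        sumTensor F finSumFinEquiv.symm (adelicMpCont.omega F (Fin n) T S Φ₁) Ψ₂)
    (Φ₁ Ψ₂ : piSchwartzBruhat F (Fin n)) :
    adelicMpCont.omega F (Fin (n + n)) (doubledGramFin F T)
        (ratThetaLiftCont F (doubledGramFin F T) (isUnit_det_doubledGramFin F T hT) x * M *
          (ratThetaLiftCont F (doubledGramFin F T) (isUnit_det_doubledGramFin F T hT) x)⁻¹)
        (sumTensor F finSumFinEquiv.symm Φ₁ Ψ₂) =
      sumTensor F finSumFinEquiv.symm
        (adelicMpCont.omega F (Fin n) T (ratThetaLiftCont F T hT x₁ * S * (ratThetaLiftCont F T hT x₁)⁻¹) Φ₁) Ψ₂ := by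
  have hx' := ratSp_inv_eq_spSum F T hT hT' x x₁ x₂ hx
  -- step 1: `ω□(r□ x⁻¹)(Φ₁ ⊠ Ψ₂) = ω(r x₁⁻¹)Φ₁ ⊠ ω₋(r x₂⁻¹)Ψ₂`
  have e1 : adelicMpCont.omega F (Fin (n + n)) (doubledGramFin F T)
      (ratThetaLiftCont F (doubledGramFin F T) (isUnit_det_doubledGramFin F T hT) x⁻¹) (sumTensor F finSumFinEquiv.symm Φ₁ Ψ₂) =
      sumTensor F finSumFinEquiv.symm (adelicMpCont.omega F (Fin n) T (ratThetaLiftCont F T hT x₁⁻¹) Φ₁)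
        (adelicMpCont.omega F (Fin n) (-T) (ratThetaLiftCont F (-T) hT' x₂⁻¹) Ψ₂) :=
    omega_ratThetaLiftCont_sumTensor_of_ratSp_eq F T hT hT' x⁻¹ x₁⁻¹ x₂⁻¹ hx' Φ₁ Ψ₂
  -- step 3: `ω□(r□ x)` on the resulting pure tensor, and the second slot cancels
  have e3 := omega_ratThetaLiftCont_sumTensor_of_ratSp_eq F T hT hT' x x₁ x₂ hx
    (adelicMpCont.omega F (Fin n) T S (adelicMpCont.omega F (Fin n) T (ratThetaLiftCont F T hT x₁⁻¹) Φ₁))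
    (adelicMpCont.omega F (Fin n) (-T) (ratThetaLiftCont F (-T) hT' x₂⁻¹) Ψ₂)
  have e4 : adelicMpCont.omega F (Fin n) (-T) (ratThetaLiftCont F (-T) hT' x₂)
      (adelicMpCont.omega F (Fin n) (-T) (ratThetaLiftCont F (-T) hT' x₂⁻¹) Ψ₂) = Ψ₂ :=
    (congrArg (fun t => adelicMpCont.omega F (Fin n) (-T) (ratThetaLiftCont F (-T) hT' x₂)
      (adelicMpCont.omega F (Fin n) (-T) t Ψ₂)) (map_inv (ratThetaLiftCont F (-T) hT') x₂)).trans
      (omega_apply_omega_inv_apply F (-T) _ Ψ₂)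
  -- the right-hand side unfolded: `ω(r x₁ · S · (r x₁)⁻¹) Φ₁ = ω(r x₁)(ω S (ω(r x₁⁻¹) Φ₁))`
  have eR : adelicMpCont.omega F (Fin n) T (ratThetaLiftCont F T hT x₁ * S * (ratThetaLiftCont F T hT x₁)⁻¹) Φ₁ =
      adelicMpCont.omega F (Fin n) T (ratThetaLiftCont F T hT x₁)
        (adelicMpCont.omega F (Fin n) T S (adelicMpCont.omega F (Fin n) T (ratThetaLiftCont F T hT x₁⁻¹) Φ₁)) :=
    (omega_mul_mul_apply F T _ _ _ Φ₁).trans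
      (congrArg (fun t => adelicMpCont.omega F (Fin n) T (ratThetaLiftCont F T hT x₁) (adelicMpCont.omega F (Fin n) T S
        (adelicMpCont.omega F (Fin n) T t Φ₁))) (map_inv (ratThetaLiftCont F T hT) x₁).symm)
  -- assemble the left-hand side
  refine ((omega_mul_mul_apply F (doubledGramFin F T) _ _ _ _).trans ?_).trans (congrArg (fun w => sumTensor F finSumFinEquiv.symm w Ψ₂) eR).symm
  refine (congrArg (fun t => adelicMpCont.omega F (Fin (n + n)) (doubledGramFin F T)
      (ratThetaLiftCont F (doubledGramFin F T) (isUnit_det_doubledGramFin F T hT) x)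
      (adelicMpCont.omega F (Fin (n + n)) (doubledGramFin F T) M
        (adelicMpCont.omega F (Fin (n + n)) (doubledGramFin F T) t (sumTensor F finSumFinEquiv.symm Φ₁ Ψ₂))))
    (map_inv (ratThetaLiftCont F (doubledGramFin F T) (isUnit_det_doubledGramFin F T hT)) x).symm).trans ?_
  refine (congrArg (fun w => adelicMpCont.omega F (Fin (n + n)) (doubledGramFin F T)
      (ratThetaLiftCont F (doubledGramFin F T) (isUnit_det_doubledGramFin F T hT) x)
      (adelicMpCont.omega F (Fin (n + n)) (doubledGramFin F T) M w)) e1).trans ?_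
  refine (congrArg (fun w => adelicMpCont.omega F (Fin (n + n)) (doubledGramFin F T)
      (ratThetaLiftCont F (doubledGramFin F T) (isUnit_det_doubledGramFin F T hT) x) w) (hM _ _)).trans ?_
  exact e3.trans (congrArg (sumTensor F finSumFinEquiv.symm _) e4)

/-! ## (β2) The origin scalar descends from `A ⊠ 1` to `A` -/

/-- **the origin scalar of `A ⊠ 1` on pure tensors IS that of `A`** (read on ONE second factor `Ψ₂` with `Ψ₂(0) ≠ 0`): if
`ω□ N (Φ₁ ⊠ Ψ₂) = ω A Φ₁ ⊠ Ψ₂` for all pure tensors and `(ω□ N (Φ₁ ⊠ Ψ₂))(0) = c · (Φ₁ ⊠ Ψ₂)(0)` for all pure tensors, then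
`(ω A Φ₁)(0) = c · Φ₁(0)` for every `Φ₁`. [cite: Weil1964, Chap. III n° 38 pp. 189–190] -/
theorem originScalar_of_sumTensor (N : adelicMpCont F (Fin (n + n)) (doubledGramFin F T)) (A : adelicMpCont F (Fin n) T)
    (hN : ∀ Φ₁ Ψ₂ : piSchwartzBruhat F (Fin n),
      adelicMpCont.omega F (Fin (n + n)) (doubledGramFin F T) N (sumTensor F finSumFinEquiv.symm Φ₁ Ψ₂) =
        sumTensor F finSumFinEquiv.symm (adelicMpCont.omega F (Fin n) T A Φ₁) Ψ₂)
    (c : ℂ)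
    (hc : ∀ Φ₁ Ψ₂ : piSchwartzBruhat F (Fin n),
      ((adelicMpCont.omega F (Fin (n + n)) (doubledGramFin F T) N (sumTensor F finSumFinEquiv.symm Φ₁ Ψ₂) :
          piSchwartzBruhat F (Fin (n + n))) : (Fin (n + n) → AdeleRing (𝓞 F) F) → ℂ) 0 =
        c * (sumTensor F finSumFinEquiv.symm Φ₁ Ψ₂ : (Fin (n + n) → AdeleRing (𝓞 F) F) → ℂ) 0)
    (Ψ₂ : piSchwartzBruhat F (Fin n)) (hΨ₂ : (Ψ₂ : (Fin n → AdeleRing (𝓞 F) F) → ℂ) 0 ≠ 0)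
    (Φ₁ : piSchwartzBruhat F (Fin n)) :
    ((adelicMpCont.omega F (Fin n) T A Φ₁ : piSchwartzBruhat F (Fin n)) : (Fin n → AdeleRing (𝓞 F) F) → ℂ) 0 =
      c * (Φ₁ : (Fin n → AdeleRing (𝓞 F) F) → ℂ) 0 := by
  have h1 : ((adelicMpCont.omega F (Fin (n + n)) (doubledGramFin F T) N (sumTensor F finSumFinEquiv.symm Φ₁ Ψ₂) :
        piSchwartzBruhat F (Fin (n + n))) : (Fin (n + n) → AdeleRing (𝓞 F) F) → ℂ) 0 =
      ((adelicMpCont.omega F (Fin n) T A Φ₁ : piSchwartzBruhat F (Fin n)) : (Fin n → AdeleRing (𝓞 F) F) → ℂ) 0 *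
        (Ψ₂ : (Fin n → AdeleRing (𝓞 F) F) → ℂ) 0 :=
    (congrArg (fun w : piSchwartzBruhat F (Fin (n + n)) => (w : (Fin (n + n) → AdeleRing (𝓞 F) F) → ℂ) 0) (hN Φ₁ Ψ₂)).trans
      (coe_sumTensor_apply_zero F _ _)
  have h2 := ((h1.symm.trans (hc Φ₁ Ψ₂)).trans (congrArg (fun t => c * t) (coe_sumTensor_apply_zero F Φ₁ Ψ₂))).trans
    (mul_assoc _ _ _).symm
  exact mul_right_cancel₀ hΨ₂ h2

/-- **converse: an origin scalar of `A` is an origin scalar of `A ⊠ 1` on pure tensors.** [cite: Weil1964, Chap. III n° 38 pp. 189–190] -/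
theorem originScalar_sumTensor_of_factor (N : adelicMpCont F (Fin (n + n)) (doubledGramFin F T)) (A : adelicMpCont F (Fin n) T)
    (hN : ∀ Φ₁ Ψ₂ : piSchwartzBruhat F (Fin n),
      adelicMpCont.omega F (Fin (n + n)) (doubledGramFin F T) N (sumTensor F finSumFinEquiv.symm Φ₁ Ψ₂) =
        sumTensor F finSumFinEquiv.symm (adelicMpCont.omega F (Fin n) T A Φ₁) Ψ₂)
    (c : ℂ)
    (hA : ∀ Φ₁ : piSchwartzBruhat F (Fin n),
      ((adelicMpCont.omega F (Fin n) T A Φ₁ : piSchwartzBruhat F (Fin n)) : (Fin n → AdeleRing (𝓞 F) F) → ℂ) 0 =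
        c * (Φ₁ : (Fin n → AdeleRing (𝓞 F) F) → ℂ) 0)
    (Φ₁ Ψ₂ : piSchwartzBruhat F (Fin n)) :
    ((adelicMpCont.omega F (Fin (n + n)) (doubledGramFin F T) N (sumTensor F finSumFinEquiv.symm Φ₁ Ψ₂) :
        piSchwartzBruhat F (Fin (n + n))) : (Fin (n + n) → AdeleRing (𝓞 F) F) → ℂ) 0 =
      c * (sumTensor F finSumFinEquiv.symm Φ₁ Ψ₂ : (Fin (n + n) → AdeleRing (𝓞 F) F) → ℂ) 0 :=
  (congrArg (fun w : piSchwartzBruhat F (Fin (n + n)) => (w : (Fin (n + n) → AdeleRing (𝓞 F) F) → ℂ) 0) (hN Φ₁ Ψ₂)).trans <|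
    (coe_sumTensor_apply_zero F _ _).trans <| (congrArg (fun t => t * (Ψ₂ : (Fin n → AdeleRing (𝓞 F) F) → ℂ) 0) (hA Φ₁)).trans <|
      (mul_assoc _ _ _).trans (congrArg (fun t => c * t) (coe_sumTensor_apply_zero F Φ₁ Ψ₂)).symm

include hT in
/-- **(β1) + (β2) together — the transport step of the model identification**: if `M` acts on pure tensors as `ω S ⊠ 1`, `x = x₁ ⊕ x₂`
is rational block-diagonal and `r_F^□(x) · M · r_F^□(x)⁻¹` has origin scalar `c` on pure tensors, then `r_F x₁ · S · (r_F x₁)⁻¹` has origin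
scalar `c` (tested on one `Ψ₂` with `Ψ₂(0) ≠ 0`). [cite: Weil1964, Chap. III n° 38 pp. 189–190 and n° 41 Thm 6 p. 193] -/
theorem originScalar_conj_ratThetaLiftCont_of_sumTensor (x : Matrix.symplecticGroup (Fin (n + n)) F)
    (x₁ x₂ : Matrix.symplecticGroup (Fin n) F)
    (hx : ratSp F (doubledGramFin F T) (isUnit_det_doubledGramFin F T hT) x =
      spReindex finSumFinEquiv (Matrix.fromBlocks T 0 0 (-T)) (spSum T (-T) (ratSp F T hT x₁, ratSp F (-T) hT' x₂)))
    (M : adelicMpCont F (Fin (n + n)) (doubledGramFin F T)) (S : adelicMpCont F (Fin n) T)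
    (hM : ∀ Φ₁ Ψ₂ : piSchwartzBruhat F (Fin n),
      adelicMpCont.omega F (Fin (n + n)) (doubledGramFin F T) M (sumTensor F finSumFinEquiv.symm Φ₁ Ψ₂) =
        sumTensor F finSumFinEquiv.symm (adelicMpCont.omega F (Fin n) T S Φ₁) Ψ₂)
    (c : ℂ)
    (hc : ∀ Φ₁ Ψ₂ : piSchwartzBruhat F (Fin n),
      ((adelicMpCont.omega F (Fin (n + n)) (doubledGramFin F T)
          (ratThetaLiftCont F (doubledGramFin F T) (isUnit_det_doubledGramFin F T hT) x * M *
            (ratThetaLiftCont F (doubledGramFin F T) (isUnit_det_doubledGramFin F T hT) x)⁻¹)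
          (sumTensor F finSumFinEquiv.symm Φ₁ Ψ₂) : piSchwartzBruhat F (Fin (n + n))) :
            (Fin (n + n) → AdeleRing (𝓞 F) F) → ℂ) 0 =
        c * (sumTensor F finSumFinEquiv.symm Φ₁ Ψ₂ : (Fin (n + n) → AdeleRing (𝓞 F) F) → ℂ) 0)
    (Ψ₂ : piSchwartzBruhat F (Fin n)) (hΨ₂ : (Ψ₂ : (Fin n → AdeleRing (𝓞 F) F) → ℂ) 0 ≠ 0)
    (Φ₁ : piSchwartzBruhat F (Fin n)) :
    ((adelicMpCont.omega F (Fin n) T (ratThetaLiftCont F T hT x₁ * S * (ratThetaLiftCont F T hT x₁)⁻¹) Φ₁ :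
        piSchwartzBruhat F (Fin n)) : (Fin n → AdeleRing (𝓞 F) F) → ℂ) 0 =
      c * (Φ₁ : (Fin n → AdeleRing (𝓞 F) F) → ℂ) 0 :=
  originScalar_of_sumTensor F T _ _ (omega_conj_ratThetaLiftCont_sumTensor F T hT hT' x x₁ x₂ hx M S hM) c hc Ψ₂ hΨ₂ Φ₁

end RationalSum

end Literature.NumberTheory.Weil1964

end
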